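/-
Copyright (c) 2026 the pub-hodgecm-mathlib formalisation cell (harness21).  Prover seat hodgecm-mathlib-LH4-p09 (g5): Track A «(D-RAM) FOUR-FRAME» squad of crux H413, unit U2H (ii-H),
leaf (ρ2b′-X) — payer LH4-p14 (g4) socket (C) brick (C2) «H-SIDE CLOSED FORM», the CLASS LINK: an inert ∕ Eisenstein datum of `D` read in a quadratic field containing `√D`, 2026-09-04.
-/
import Literature.NumberTheory.Automorphic.ValuedFieldValuativeRelBridge   -- ★ `v_lt_one_iff_valuation_lt_one`, `v_le_one_iff_mem_integer`, `v_eq_iff_valuation_eq` (Valued ↔ ValuativeRel currencies)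
import HarnessLib

/-!
# The ramification type of `F(√D)` read off a quadratic datum of `D`: an EISENSTEIN datum is impossible when `F → F(√D)` is isometric (unramified), an INERT datum is impossible
# when `|ι y| = |y|²` with residue degree one (ramified) (Serre, *Local Fields* I §6, III §5; Labesse–Langlands 1979 §2)

Topic `NumberTheory/Automorphic`; namespace `Literature.NumberTheory.Automorphic.HermitianLatticeTree` (as ★ `QuadraticDatumOfNonsquare`, ★ `SLTwoTreeDeepEllipticTorusDatum`).  THEOREMS
ONLY (no definition, no instance, no notation, no named fact, no `sorry`); kernel lane `--supports stmt-HodgeConjecture-24833` (count-neutral).  Cell `pub/hodgecm-mathlib` (D-0151), crux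
H413; Track A «(D-RAM) FOUR-FRAME», unit U2H (ii-H), leaf (ρ2b′-X) `stub_U2H_fixedPointCensus_typeTwo_unit0` (U2H ED. 15 :418): payer LH4-p14 (g4)'s socket (C), brick (C2) «H-SIDE
CLOSED FORM» (this seat: ★ p857582 ∕ p857631 ∕ p857663 ∕ p857701).  ★ p857701 `hSide_closedForm_of_tube` returns, for the descent `g` of a type-(2) `γ₂`, an INERT or an EISENSTEIN
datum `(u, w, z)` of `D = tr²g − 4 det g` (★ p857631 ∘ ★ `exists_inert_or_eisenstein_datum`) together with the corresponding ℕ-law of `#Fix_{γ₂}(U₂ ⧸ K₂) + d % 2`; the census file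
(payer, (C0)) splits instead on the RAMIFICATION of the third field `K″ = Fix(cθ)` of the eigen-package's biquadratic model (S2′ route (a), LH4-p05 (g4) ∕ LH4-p07 (g7) ∕ LH4-p10 (g3)
LINE #13), whose completion at the place `v″` under `w′` contains `√D` and receives `ι = toPlace v v″` with `|ι y| = |y|^{e(v″|v)}` (★ `valued_toPlace`).  THIS FILE is the
dictionary between the two splits, in generic valued-field letters: the branch of ★ p857701 the census file is NOT in is refuted by (i) or (ii) below (`Or.resolve_left∕right`).

THE MATHEMATICS (`ι : F →+* K` a ring map of `ℤᵐ⁰`-valued fields, `r ∈ K` with `r² = ι D`, `D = (u² + 4w)·z²`, `z ≠ 0`, `2 ≠ 0` in `K`).  The element `τ := (ιu + r∕ιz)∕2` and its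
conjugate `τ′ := ιu − τ` satisfy `τ + τ′ = ιu`, `τ·τ′ = −ιw` (§1 `root_sum_and_prod`): they are the roots of `X² − ιu·X − ιw` in `K`.
* (i) `false_of_eisenstein_of_isometry` — if `ι` is ISOMETRIC (`|ι y| = |y|`: `e = 1`) there is NO Eisenstein datum (`|u| < 1`, `|w| = exp(−1)`): `|τ|·|τ′| = exp(−1)` forces
  `|τ| ≠ |τ′|` (a square is never `exp(−1)`), so `|ιu| = |τ + τ′| = max(|τ|, |τ′|) < 1`, whence both `≤ exp(−1)` and `|τ|·|τ′| ≤ exp(−2)` — contradiction.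
* (ii) `false_of_inert_of_sq_of_residue` — if `|ι y| = |y|²` (`e = 2`) and every integer of `K` is congruent to some `ι c` modulo the maximal ideal (`f = 1`), there is NO inert datum
  (`|u|, |w| ≤ 1`, norm form `c² + ceu − e²w` anisotropic mod `𝔭`): `τ, τ′` are integral, `|τ − ιc| < 1` for some `c`, and `(ιc − τ)(ιc − τ′) = ι(c² − cu − w)` has value `< 1`, so
  `|c² − cu − w| < 1` — the vector `(c, −1)` is residually isotropic.
* §3 the same two with the datum in the `ValuativeRel` letters of ★ p857701 ∕ ★ p857631 (`u ∈ 𝒪[F]`, `valuation F u < 1`, `valuation F w = valuation F ϖ`, `hanis` over `𝒪[F]`) for an `F`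
  carrying compatible `Valued`∕`ValuativeRel` structures (★ bridge) — `false_of_eisensteinDatum_of_isometry`, `false_of_inertDatum_of_sq_of_residue`.
So, at the S2′ letters: `e(v″|v) = 1` ⇒ ★ p857701's INERT branch (law `(q + 1)qⁿ`, class U of heir LEAD T19-05 (1)); `e(v″|v) = 2` (then `f(v″|v) = 1`) ⇒ its EISENSTEIN branch (law
`2q^{n+1}`, classes RK ∕ RM).  HONEST LABEL: HC_CM is proved only modulo the 7 printed citations (2 remaining named inputs: hLiu418 = stmt-HodgeConjecture-24832, h413 =
stmt-HodgeConjecture-24833) until rung 0 closes; (ρ2b′-X) stays OPEN; nothing printed is asserted — elementary valuation theory.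

## References
* [Serre1979] J.-P. Serre, *Local Fields*, GTM 67 (1979), Ch. I §6 Prop. 17–18 (Eisenstein equations: a root of an Eisenstein polynomial is a uniformiser, `e = 2`), Ch. III §5 Thm. 3
  (unramified extensions: the residue extension is generated by the reduction of an inert polynomial's root, `f = 2`).
* [LabesseLanglands1979] J.-P. Labesse, R. P. Langlands, *L-indistinguishability for SL(2)*, Canad. J. Math. 31 (1979), §2 pp. 7–8 (the quadratic tori of `GL₂`: unramified vs ramified `𝒪[τ]`).
-/

set_option autoImplicit false

noncomputable section

open scoped WithZero
open WithZero

namespace Literature.NumberTheory.Automorphic.HermitianLatticeTree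

/-! ## §1 The two roots `τ, τ′` of `X² − ιu·X − ιw` attached to a datum -/

section Roots

variable {F K : Type*} [Field F] [Field K]

/-- For `r² = ι D`, `D = (u² + 4w)·z²`, `z ≠ 0`, `2 ≠ 0`: `τ := (ιu + r∕ιz)∕2` and `τ′ := ιu − τ` have **`τ + τ′ = ιu`** and **`τ·τ′ = −ιw`**. [cite: LabesseLanglands1979, §2 p. 8] -/
theorem root_sum_and_prod (ι : F →+* K) (h2 : (2 : K) ≠ 0) {D u w z : F} (hD : (u ^ 2 + 4 * w) * z ^ 2 = D) (hz : z ≠ 0) {r : K} (hr : r ^ 2 = ι D) :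
    (ι u + r / ι z) / 2 + (ι u - (ι u + r / ι z) / 2) = ι u ∧ (ι u + r / ι z) / 2 * (ι u - (ι u + r / ι z) / 2) = -ι w := by
  refine ⟨by ring, ?_⟩
  have hιz : ι z ≠ 0 := (map_ne_zero ι).2 hz
  have hq : (r / ι z) ^ 2 = ι u ^ 2 + 4 * ι w := by
    rw [div_pow, hr, ← hD, map_mul, map_pow, map_add, map_pow, map_mul, map_ofNat]
    field_simp
  have h4 : (4 : K) ≠ 0 := by
    have : (4 : K) = 2 * 2 := by norm_num
    rw [this]; exact mul_ne_zero h2 h2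
  apply mul_left_cancel₀ h4
  have : (4 : K) * ((ι u + r / ι z) / 2 * (ι u - (ι u + r / ι z) / 2)) = ι u ^ 2 - (r / ι z) ^ 2 := by
    field_simp
    ring
  rw [this, hq]; ring

end Roots

/-! ## §2 The two impossibilities (generic `ℤᵐ⁰`-valued fields) -/

section Valued

variable {F K : Type*} [Field F] [Field K] [Valued F ℤᵐ⁰] [Valued K ℤᵐ⁰]

/-- Two non-zero values of `ℤᵐ⁰` with product `exp(−1)` are DISTINCT and the larger one is `≥ 1` (`exp a · exp b = exp(−1)` forces `a ≠ b` by parity and `max(a,b) ≥ 0`).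
[cite: Serre1979, Ch. I §6 Prop. 17] -/
theorem one_le_max_of_mul_eq_exp_neg_one {a b : ℤᵐ⁰} (ha : a ≠ 0) (hb : b ≠ 0) (hab : a * b = exp (-1 : ℤ)) : a ≠ b ∧ 1 ≤ max a b := by
  rw [← exp_log ha, ← exp_log hb, ← exp_add, exp_inj] at hab
  refine ⟨?_, ?_⟩
  · intro h
    rw [h] at hab
    omega
  · rw [← exp_log ha, ← exp_log hb, ← exp_zero]
    rcases le_total (log a) (log b) with h | h
    · rw [max_eq_right (exp_le_exp.2 h), exp_le_exp]; omega
    · rw [max_eq_left (exp_le_exp.2 h), exp_le_exp]; omega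

/-- **(i) AN EISENSTEIN DATUM OF `D` IS IMPOSSIBLE WHEN `F → F(√D)` IS ISOMETRIC.**  `ι : F →+* K` with `|ι y| = |y|` for all `y` (ramification index `1`), `r ∈ K` with `r² = ι D`,
`D = (u² + 4w)·z²` (`z ≠ 0`, `2 ≠ 0` in `K`), `|u| < 1`, `|w| = exp(−1)`: contradiction (see the module docstring). [cite: Serre1979, Ch. I §6 Prop. 17–18] [cite: LabesseLanglands1979, §2 p. 8] -/
theorem false_of_eisenstein_of_isometry (ι : F →+* K) (hι : ∀ y, Valued.v (ι y) = Valued.v y) (h2 : (2 : K) ≠ 0)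
    {D u w z : F} (hD : (u ^ 2 + 4 * w) * z ^ 2 = D) (hz : z ≠ 0) (hu : Valued.v u < 1) (hw : Valued.v w = exp (-1 : ℤ))
    {r : K} (hr : r ^ 2 = ι D) : False := by
  obtain ⟨hsum, hprod⟩ := root_sum_and_prod ι h2 hD hz hr
  set τ : K := (ι u + r / ι z) / 2 with hτ
  set τ' : K := ι u - (ι u + r / ι z) / 2 with hτ'
  have hvprod : Valued.v τ * Valued.v τ' = exp (-1 : ℤ) := by rw [← map_mul, hprod, Valuation.map_neg, hι, hw]
  have hτ0 : Valued.v τ ≠ 0 := fun h => by rw [h, zero_mul] at hvprod; exact (exp_ne_zero hvprod.symm).elim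
  have hτ'0 : Valued.v τ' ≠ 0 := fun h => by rw [h, mul_zero] at hvprod; exact (exp_ne_zero hvprod.symm).elim
  obtain ⟨hne, hmax⟩ := one_le_max_of_mul_eq_exp_neg_one hτ0 hτ'0 hvprod
  have hvsum : Valued.v (τ + τ') = max (Valued.v τ) (Valued.v τ') := Valuation.map_add_of_distinct_val _ hne
  rw [hsum, hι] at hvsum
  rw [← hvsum] at hmax
  exact absurd hu (not_lt.2 hmax)

/-- **(ii) AN INERT DATUM OF `D` IS IMPOSSIBLE WHEN `|ι y| = |y|²` WITH RESIDUE DEGREE ONE.**  `ι : F →+* K` with `|ι y| = |y|²` (ramification index `2`) and the residue approximation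
`∀ x, |x| ≤ 1 → ∃ c, |c| ≤ 1 ∧ |x − ι c| < 1` (residue degree `1`), `r² = ι D`, `D = (u² + 4w)·z²` (`z ≠ 0`, `2 ≠ 0` in `K`), `|u| ≤ 1`, `|w| ≤ 1` and the norm form
`c² + ceu − e²w` anisotropic modulo `𝔭` (`|c|, |e| ≤ 1`, value `< 1` ⇒ `|c|, |e| < 1`): contradiction (see the module docstring). [cite: Serre1979, Ch. III §5 Thm. 3] [cite: LabesseLanglands1979, §2 p. 8] -/
theorem false_of_inert_of_sq_of_residue (ι : F →+* K) (hι : ∀ y, Valued.v (ι y) = Valued.v y ^ 2)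
    (hres : ∀ x : K, Valued.v x ≤ 1 → ∃ c : F, Valued.v c ≤ 1 ∧ Valued.v (x - ι c) < 1) (h2 : (2 : K) ≠ 0)
    {D u w z : F} (hD : (u ^ 2 + 4 * w) * z ^ 2 = D) (hz : z ≠ 0) (hu : Valued.v u ≤ 1) (hw : Valued.v w ≤ 1)
    (hanis : ∀ c e : F, Valued.v c ≤ 1 → Valued.v e ≤ 1 → Valued.v (c ^ 2 + c * e * u - e ^ 2 * w) < 1 → Valued.v c < 1 ∧ Valued.v e < 1)
    {r : K} (hr : r ^ 2 = ι D) : False := by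
  obtain ⟨hsum, hprod⟩ := root_sum_and_prod ι h2 hD hz hr
  set τ : K := (ι u + r / ι z) / 2 with hτ
  set τ' : K := ι u - (ι u + r / ι z) / 2 with hτ'
  have hιu : Valued.v (ι u) ≤ 1 := by rw [hι]; exact pow_le_one₀ zero_le hu
  have hιw : Valued.v (ι w) ≤ 1 := by rw [hι]; exact pow_le_one₀ zero_le hw
  have hvprod : Valued.v τ * Valued.v τ' = Valued.v (ι w) := by rw [← map_mul, hprod, Valuation.map_neg]
  -- both roots are integral
  have hint : ∀ x y : K, x + y = ι u → Valued.v x * Valued.v y = Valued.v (ι w) → Valued.v x ≤ 1 := by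
    intro x y hxy hxyw
    by_contra hgt
    rw [not_le] at hgt
    have hx0 : Valued.v x ≠ 0 := ne_of_gt (lt_trans zero_lt_one hgt)
    have hy : Valued.v y < Valued.v x := by
      by_contra hyx
      rw [not_lt] at hyx
      have : Valued.v x * Valued.v x ≤ Valued.v x * Valued.v y := mul_le_mul' le_rfl hyx
      rw [hxyw] at this
      have h1 : (1 : ℤᵐ⁰) < Valued.v x * Valued.v x := one_lt_mul'' hgt hgt
      exact absurd (lt_of_lt_of_le h1 this) (not_lt.2 hιw)
    have := Valuation.map_add_eq_of_lt_left Valued.v hy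
    rw [hxy] at this
    rw [this] at hιu
    exact absurd hgt (not_lt.2 hιu)
  have hτ1 : Valued.v τ ≤ 1 := hint τ τ' hsum hvprod
  have hτ'1 : Valued.v τ' ≤ 1 := hint τ' τ (by rw [add_comm]; exact hsum) (by rw [mul_comm]; exact hvprod)
  -- approximate `τ` by `ι c`
  obtain ⟨c, hc1, hcτ⟩ := hres τ hτ1
  have hN : (ι c - τ) * (ι c - τ') = ι (c ^ 2 - c * u - w) := by
    have e1 : (ι c - τ) * (ι c - τ') = ι c ^ 2 - ι c * (τ + τ') + τ * τ' := by ring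
    rw [e1, hsum, hprod, map_sub, map_sub, map_pow, map_mul]; ring
  have hvN : Valued.v (ι (c ^ 2 - c * u - w)) < 1 := by
    rw [← hN, map_mul]
    have h1 : Valued.v (ι c - τ) < 1 := by rw [← Valuation.map_neg, neg_sub]; exact hcτ
    have h2' : Valued.v (ι c - τ') ≤ 1 := by
      refine le_trans (Valuation.map_sub _ _ _) (max_le ?_ hτ'1)
      rw [hι]; exact pow_le_one₀ zero_le hc1
    calc Valued.v (ι c - τ) * Valued.v (ι c - τ') ≤ Valued.v (ι c - τ) * 1 := mul_le_mul' le_rfl h2'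
      _ < 1 := by rw [mul_one]; exact h1
  rw [hι] at hvN
  have hvF : Valued.v (c ^ 2 - c * u - w) < 1 := by
    by_contra hge
    rw [not_lt] at hge
    exact absurd hvN (not_lt.2 (one_le_pow₀ hge))
  have h := hanis c (-1) hc1 (by rw [Valuation.map_neg, Valuation.map_one])
    (by rw [show c ^ 2 + c * (-1) * u - (-1) ^ 2 * w = c ^ 2 - c * u - w by ring]; exact hvF)
  rw [Valuation.map_neg, Valuation.map_one] at h
  exact lt_irrefl _ h.2

end Valued

/-! ## §3 The same with the datum in the `ValuativeRel` letters of ★ `exists_torusDatum_of_deep` ∕ ★ `hSide_closedForm_of_tube` -/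

section Bridge

open ValuativeRel
open scoped ValuativeRel

variable {F K : Type*} [Field F] [Field K] [Valued F ℤᵐ⁰] [ValuativeRel F] [(Valued.v : Valuation F ℤᵐ⁰).Compatible] [Valued K ℤᵐ⁰]

/-- **(i′) NO EISENSTEIN DATUM UNDER AN ISOMETRY — datum in `ValuativeRel` letters** (`u ∈ 𝒪[F]` not needed; `valuation F u < 1`, `valuation F w = valuation F ϖ` with `|ϖ| = exp(−1)`).
[cite: Serre1979, Ch. I §6 Prop. 17–18] -/
theorem false_of_eisensteinDatum_of_isometry (ι : F →+* K) (hι : ∀ y, Valued.v (ι y) = Valued.v y) (h2 : (2 : K) ≠ 0)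
    {ϖ : F} (hϖ : Valued.v ϖ = exp (-1 : ℤ)) {D u w z : F} (hD : (u ^ 2 + 4 * w) * z ^ 2 = D) (hz : z ≠ 0)
    (hu : valuation F u < 1) (hw : valuation F w = valuation F ϖ) {r : K} (hr : r ^ 2 = ι D) : False :=
  false_of_eisenstein_of_isometry ι hι h2 hD hz ((v_lt_one_iff_valuation_lt_one u).2 hu) (by rw [(v_eq_iff_valuation_eq w ϖ).2 hw, hϖ]) hr

/-- **(ii′) NO INERT DATUM WHEN `|ι y| = |y|²` WITH RESIDUE DEGREE ONE — datum in `ValuativeRel` letters** (`u w ∈ 𝒪[F]`, `hanis` over `𝒪[F]` with `valuation F`).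
[cite: Serre1979, Ch. III §5 Thm. 3] -/
theorem false_of_inertDatum_of_sq_of_residue (ι : F →+* K) (hι : ∀ y, Valued.v (ι y) = Valued.v y ^ 2)
    (hres : ∀ x : K, Valued.v x ≤ 1 → ∃ c : F, Valued.v c ≤ 1 ∧ Valued.v (x - ι c) < 1) (h2 : (2 : K) ≠ 0)
    {D u w z : F} (hD : (u ^ 2 + 4 * w) * z ^ 2 = D) (hz : z ≠ 0) (hu : u ∈ 𝒪[F]) (hw : w ∈ 𝒪[F])
    (hanis : ∀ c e : F, c ∈ 𝒪[F] → e ∈ 𝒪[F] → valuation F (c ^ 2 + c * e * u - e ^ 2 * w) < 1 → valuation F c < 1 ∧ valuation F e < 1)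
    {r : K} (hr : r ^ 2 = ι D) : False := by
  refine false_of_inert_of_sq_of_residue ι hι hres h2 hD hz ((v_le_one_iff_mem_integer u).2 hu) ((v_le_one_iff_mem_integer w).2 hw) ?_ hr
  intro c e hc he hlt
  have h := hanis c e ((v_le_one_iff_mem_integer c).1 hc) ((v_le_one_iff_mem_integer e).1 he) ((v_lt_one_iff_valuation_lt_one _).1 hlt)
  exact ⟨(v_lt_one_iff_valuation_lt_one c).2 h.1, (v_lt_one_iff_valuation_lt_one e).2 h.2⟩

end Bridge

end Literature.NumberTheory.Automorphic.HermitianLatticeTree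

end
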